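import Summits.QuantumFields.YangMills.Theorems.ColdStartUniversalityColdStartSolutionsExistPicardIntegrals
import Summits.QuantumFields.YangMills.Theorems.ColdStartUniversalityColdStartSolutionsExistFlatFiltration
import Literature.Probability.Process.ItoIntegralNegation
import HarnessLib

/-!
# Route `ColdStartUniversality`, support item S (stmt-QuantumFields-24811), line `piwiener`:
# stub B reduced to a generic statement — "tangent Itô systems keep the sum of squares"

Helper file (lead `ym-line-csu-p1`).  The registered stub B `stub_frobeniusNormPreserved` (every ambient
solution of a tame TANGENT link SDE keeps `‖X_e(t)‖_F² = ‖Q₀,e‖_F²`) is an instance, link by link and in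
the `8` real coordinates `Re/Im X_e,ij`, of the following GENERIC statement of stochastic calculus on a
probability space carrying a Brownian vector `W` (joint raw filtration `𝓕`), spelled out below as the
hypothesis `hT` of `frobenius_preserved_of_tangent` (it is the new registered stub `stub_tangentSumSq` of
the skeleton `Cruxes/ColdStartSolutionsExist/Lines/piwiener.lean`, v6):

> if real processes `Y_k = y_k + ∫₀ b_k ds + Σₙ J_{k,n}` (`k ∈ K` finite) have `𝓕`-progressive
> coordinates/drifts/diffusion coefficients with continuous paths, `J_{k,n} = ∫ σ_{k,n} dW^{c n}`
> (`c` injective, `E∫₀ᵗ σ² < ∞`), and the TANGENCY identities `2 Σ_k Y_k b_k + Σ_{k,n} σ_{k,n}² = 0`,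
> `Σ_k Y_k σ_{k,n} = 0` hold pointwise, then a.s. `Σ_k Y_k(t)² = Σ_k y_k²` for all `t`

(Itô's formula for `Σ Y_k²`: zero drift by the first identity, zero martingale part by the second).
Here: `hsForm_eq_sum_re_im` (the Hilbert–Schmidt form in real coordinates) and
`frobenius_preserved_of_tangent` (stub B, unfolded and for a general flat Brownian motion, from `hT`).

No definition, no sorry.  RECORD-rung plumbing; nothing here bears on the Yang–Mills mass gap. -/

set_option autoImplicit false

noncomputable section

namespace Summit.QuantumFields.YangMills.Theorems.ColdStartUniversality

open MeasureTheory ProbabilityTheory Filter Topology Finset Matrix Complex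
open scoped NNReal ENNReal BigOperators ComplexConjugate
open Literature.Probability.Process
open Literature.MathematicalPhysics.QuantumFieldTheory

/-- **The Hilbert–Schmidt form in real coordinates**: `⟨A, B⟩ = Σᵢⱼ (Re Aᵢⱼ Re Bᵢⱼ + Im Aᵢⱼ Im Bᵢⱼ)`.
[folklore] -/
theorem hsForm_eq_sum_re_im {N : ℕ} (A B : Matrix (Fin N) (Fin N) ℂ) :
    hsForm N A B = ∑ i, ∑ j, ((A i j).re * (B i j).re + (A i j).im * (B i j).im) := by
  rw [hsForm_apply, Matrix.trace]
  simp only [Matrix.diag_apply, Matrix.mul_apply, Matrix.conjTranspose_apply, Complex.re_sum]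
  refine Finset.sum_congr rfl fun i _ => Finset.sum_congr rfl fun j _ => ?_
  rw [Complex.star_def, Complex.mul_re, Complex.conj_re, Complex.conj_im]
  ring

/-- `Σᵢⱼ (Re² + Im²) = ‖A‖_F²`, the sum over the `8` real coordinates `(i, j, re/im)`. [folklore] -/
theorem sum_reIm_sq_eq_hsForm {N : ℕ} (A : Matrix (Fin N) (Fin N) ℂ) :
    ∑ k : Fin N × Fin N × Bool, (if k.2.2 then (A k.1 k.2.1).im else (A k.1 k.2.1).re) ^ 2 = hsForm N A A := by
  rw [hsForm_eq_sum_re_im, Fintype.sum_prod_type]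
  refine Finset.sum_congr rfl fun i _ => ?_
  rw [Fintype.sum_prod_type]
  refine Finset.sum_congr rfl fun j _ => ?_
  rw [Fintype.sum_bool]
  simp only [ite_true, Bool.false_eq_true, ite_false]
  ring

/-- Real-coordinate form of `⟨A, B⟩` as a sum over `(i, j, re/im)`. [folklore] -/
theorem sum_reIm_mul_eq_hsForm {N : ℕ} (A B : Matrix (Fin N) (Fin N) ℂ) :
    ∑ k : Fin N × Fin N × Bool, (if k.2.2 then (A k.1 k.2.1).im else (A k.1 k.2.1).re) *
      (if k.2.2 then (B k.1 k.2.1).im else (B k.1 k.2.1).re) = hsForm N A B := by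
  rw [hsForm_eq_sum_re_im, Fintype.sum_prod_type]
  refine Finset.sum_congr rfl fun i _ => ?_
  rw [Fintype.sum_prod_type]
  refine Finset.sum_congr rfl fun j _ => ?_
  rw [Fintype.sum_bool]
  simp only [ite_true, Bool.false_eq_true, ite_false]
  ring


/-- **Stub B from the generic tangent theorem.**  Let `S` be a link SDE on `M₂(ℂ)^E` with
squared-Frobenius Lipschitz coefficients satisfying the tangency identities
`2⟨b_e(Q), Q_e⟩ + Σₙ ‖σ_{e,n}(Q)‖² = 0`, `⟨σ_{e,n}(Q), Q_e⟩ = 0`; let `X` be an ambient solution on a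
probability space with a flat Brownian motion (entrywise progressive, a.s. continuous, `L²(sup)`,
entrywise Itô equations from `Q₀`).  If the generic statement `hT` ("tangent Itô systems keep the sum
of squares", the registered stub `stub_tangentSumSq`) holds, then a.s. `‖X_e(t)‖_F² = ‖Q₀,e‖_F²` for all
`t, e` — apply `hT` link by link in the `8` real coordinates `Re/Im X_e,ij`. [folklore] -/
theorem frobenius_preserved_of_tangent
    (hT : ∀ {Ω : Type} [MeasurableSpace Ω] {P : Measure Ω} [IsProbabilityMeasure P] {d : ℕ}
      {W : ℝ≥0 → Ω → (Fin d → ℝ)} (hW : IsBrownianVec W P) {ι κ : Type} [Fintype ι] [Fintype κ]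
      (c : κ → Fin d) (_hc : Function.Injective c)
      (Y : ι → ℝ≥0 → Ω → ℝ) (b : ι → ℝ≥0 → Ω → ℝ) (σ : ι → κ → ℝ≥0 → Ω → ℝ)
      (J : ι → κ → ℝ≥0 → Ω → ℝ) (y₀ : ι → ℝ),
      (∀ k, IsStronglyProgressive hW.natFiltration (Y k)) →
      (∀ k, IsStronglyProgressive hW.natFiltration (b k)) →
      (∀ k n, IsStronglyProgressive hW.natFiltration (σ k n)) →
      (∀ᵐ ω ∂P, ∀ k, Continuous fun t => Y k t ω) →
      (∀ᵐ ω ∂P, ∀ k, Continuous fun t => b k t ω) →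
      (∀ᵐ ω ∂P, ∀ k n, Continuous fun t => σ k n t ω) →
      (∀ k n (t : ℝ≥0), sqErr (σ k n) 0 P t ≠ ⊤) →
      (∀ k n, IsItoIntegral (σ k n) (fun t ω => W t ω (c n)) (J k n) hW.natFiltration P) →
      (∀ᵐ ω ∂P, ∀ (t : ℝ≥0) (k : ι),
        Y k t ω = y₀ k + (∫ s in (0 : ℝ)..t, b k s.toNNReal ω) + ∑ n, J k n t ω) →
      (∀ (t : ℝ≥0) (ω : Ω), 2 * ∑ k, Y k t ω * b k t ω + ∑ k, ∑ n, σ k n t ω ^ 2 = 0) →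
      (∀ (t : ℝ≥0) (ω : Ω) (n : κ), ∑ k, Y k t ω * σ k n t ω = 0) →
      ∀ᵐ ω ∂P, ∀ t : ℝ≥0, ∑ k, Y k t ω ^ 2 = ∑ k, y₀ k ^ 2)
    {Ω : Type} {mΩ : MeasurableSpace Ω} {P : Measure Ω} [IsProbabilityMeasure P] {L : ℕ} [NeZero L]
    {W : ℝ≥0 → Ω → (Edge 3 L × NoiseIdx 2 → ℝ)} (hW : IsFlatBrownian W P)
    (S : LinkSDE 3 L 2 (NoiseIdx 2)) {K : ℝ}
    (hSd : ∀ (Q Q' : MatrixConfig 3 L 2) (e : Edge 3 L),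
      hsForm 2 (S.drift Q e - S.drift Q' e) (S.drift Q e - S.drift Q' e) ≤
        K * ∑ e', hsForm 2 (Q e' - Q' e') (Q e' - Q' e'))
    (hSn : ∀ (Q Q' : MatrixConfig 3 L 2) (e : Edge 3 L) (n : NoiseIdx 2),
      hsForm 2 (S.noise Q e n - S.noise Q' e n) (S.noise Q e n - S.noise Q' e n) ≤
        K * ∑ e', hsForm 2 (Q e' - Q' e') (Q e' - Q' e'))
    (hT1 : ∀ (Q : MatrixConfig 3 L 2) (e : Edge 3 L),
      2 * hsForm 2 (S.drift Q e) (Q e) + ∑ n, hsForm 2 (S.noise Q e n) (S.noise Q e n) = 0)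
    (hT2 : ∀ (Q : MatrixConfig 3 L 2) (e : Edge 3 L) (n : NoiseIdx 2), hsForm 2 (S.noise Q e n) (Q e) = 0)
    (Q₀ : MatrixConfig 3 L 2) {X : ℝ≥0 → Ω → MatrixConfig 3 L 2}
    (hXp : ∀ e i j, IsStronglyProgressive hW.natFiltration (fun t ω => (X t ω e i j).re) ∧
      IsStronglyProgressive hW.natFiltration (fun t ω => (X t ω e i j).im))
    (hXc : ∀ᵐ ω ∂P, Continuous fun t => X t ω)
    (hX2 : ∀ t : ℝ≥0, ∫⁻ ω, ⨆ s ∈ Set.Iic t, ENNReal.ofReal (∑ e, hsForm 2 (X s ω e) (X s ω e)) ∂P < ∞)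
    {J : Edge 3 L → NoiseIdx 2 → Fin 2 → Fin 2 → ℝ≥0 → Ω → ℂ}
    (hJ : ∀ e n i j, IsItoIntegralC (fun t ω => S.noise (X t ω) e n i j) (fun t ω => W t ω (e, n))
      (J e n i j) hW.natFiltration P)
    (hXeq : ∀ᵐ ω ∂P, ∀ (t : ℝ≥0) (e : Edge 3 L) (i j : Fin 2),
      X t ω e i j = Q₀ e i j + (∫ s in (0 : ℝ)..t, S.drift (X s.toNNReal ω) e i j) + ∑ n, J e n i j t ω) :
    ∀ᵐ ω ∂P, ∀ (t : ℝ≥0) (e : Edge 3 L), hsForm 2 (X t ω e) (X t ω e) = hsForm 2 (Q₀ e) (Q₀ e) := by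
  classical
  have hfil := natFiltration_flat_eq hW
  -- continuity of the coefficients
  have hSdc : ∀ e, Continuous fun Q : MatrixConfig 3 L 2 => S.drift Q e := fun e =>
    continuous_of_hsForm_lipschitz fun Q Q' => hSd Q Q' e
  have hSnc : ∀ e n, Continuous fun Q : MatrixConfig 3 L 2 => S.noise Q e n := fun e n =>
    continuous_of_hsForm_lipschitz fun Q Q' => hSn Q Q' e n
  -- it suffices to treat one link at a time
  suffices hlink : ∀ e : Edge 3 L, ∀ᵐ ω ∂P, ∀ t : ℝ≥0, hsForm 2 (X t ω e) (X t ω e) = hsForm 2 (Q₀ e) (Q₀ e) by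
    have h := ae_all_iff.2 hlink
    filter_upwards [h] with ω hω t e using hω e t
  intro e
  -- the data of the generic statement, in the real coordinates `(i, j, re/im)` of the link `e`
  have hres := hT (W := fun t ω k => W t ω ((Fintype.equivFin (Edge 3 L × NoiseIdx 2)).symm k)) hW
    (ι := Fin 2 × Fin 2 × Bool) (κ := NoiseIdx 2)
    (fun n => Fintype.equivFin (Edge 3 L × NoiseIdx 2) (e, n))
    (fun n n' h => by simpa using (Fintype.equivFin (Edge 3 L × NoiseIdx 2)).injective h)
    (fun k t ω => if k.2.2 then (X t ω e k.1 k.2.1).im else (X t ω e k.1 k.2.1).re)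
    (fun k t ω => if k.2.2 then (S.drift (X t ω) e k.1 k.2.1).im else (S.drift (X t ω) e k.1 k.2.1).re)
    (fun k n t ω => if k.2.2 then (S.noise (X t ω) e n k.1 k.2.1).im else (S.noise (X t ω) e n k.1 k.2.1).re)
    (fun k n t ω => if k.2.2 then (J e n k.1 k.2.1 t ω).im else (J e n k.1 k.2.1 t ω).re)
    (fun k => if k.2.2 then (Q₀ e k.1 k.2.1).im else (Q₀ e k.1 k.2.1).re)
    ?_ ?_ ?_ ?_ ?_ ?_ ?_ ?_ ?_ ?_ ?_
  · -- conclusion: the two sums of squares are the Frobenius norms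
    filter_upwards [hres] with ω hω t
    have h := hω t
    rw [sum_reIm_sq_eq_hsForm (X t ω e), sum_reIm_sq_eq_hsForm (Q₀ e)] at h
    exact h
  · -- coordinates progressive
    rintro ⟨i, j, β⟩
    rw [← hfil]
    cases β
    · simpa using (hXp e i j).1
    · simpa using (hXp e i j).2
  · -- drifts progressive
    rintro ⟨i, j, β⟩
    rw [← hfil]
    cases β
    · simpa using isStronglyProgressive_coeff_re (hSdc e) (fun e i j => (hXp e i j).1) (fun e i j => (hXp e i j).2) i j
    · simpa using isStronglyProgressive_coeff_im (hSdc e) (fun e i j => (hXp e i j).1) (fun e i j => (hXp e i j).2) i j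
  · -- diffusion coefficients progressive
    rintro ⟨i, j, β⟩ n
    rw [← hfil]
    cases β
    · simpa using isStronglyProgressive_coeff_re (hSnc e n) (fun e i j => (hXp e i j).1) (fun e i j => (hXp e i j).2) i j
    · simpa using isStronglyProgressive_coeff_im (hSnc e n) (fun e i j => (hXp e i j).1) (fun e i j => (hXp e i j).2) i j
  · -- coordinates continuous
    filter_upwards [hXc] with ω hω
    rintro ⟨i, j, β⟩
    have hij : Continuous fun t => X t ω e i j :=
      ((continuous_apply j).comp ((continuous_apply i).comp ((continuous_apply e).comp hω)))
    cases β
    · simp only [Bool.false_eq_true, ite_false]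
      exact Complex.continuous_re.comp hij
    · simp only [ite_true]
      exact Complex.continuous_im.comp hij
  · -- drifts continuous
    filter_upwards [hXc] with ω hω
    rintro ⟨i, j, β⟩
    have hij : Continuous fun t => S.drift (X t ω) e i j :=
      ((continuous_apply j).comp ((continuous_apply i).comp ((hSdc e).comp hω)))
    cases β
    · simp only [Bool.false_eq_true, ite_false]
      exact Complex.continuous_re.comp hij
    · simp only [ite_true]
      exact Complex.continuous_im.comp hij
  · -- diffusion coefficients continuous
    filter_upwards [hXc] with ω hω
    rintro ⟨i, j, β⟩ n
    have hij : Continuous fun t => S.noise (X t ω) e n i j :=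
      ((continuous_apply j).comp ((continuous_apply i).comp ((hSnc e n).comp hω)))
    cases β
    · simp only [Bool.false_eq_true, ite_false]
      exact Complex.continuous_re.comp hij
    · simp only [ite_true]
      exact Complex.continuous_im.comp hij
  · -- square integrability of the diffusion coefficients
    rintro ⟨i, j, β⟩ n t
    have h := sqErr_coeff_entry_ne_top (f := fun Q => S.noise Q e n) (fun Q Q' => hSn Q Q' e n) hX2 i j t
    cases β
    · simpa using h.1
    · simpa using h.2
  · -- the Itô integrals
    rintro ⟨i, j, β⟩ n
    rw [← hfil]
    have h := hJ e n i j
    cases β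
    · simpa [IsItoIntegralC] using h.1
    · simpa [IsItoIntegralC] using h.2
  · -- the integral equations, real and imaginary parts
    filter_upwards [hXeq, hXc] with ω hωeq hωc t
    rintro ⟨i, j, β⟩
    have hint : IntervalIntegrable (fun s : ℝ => S.drift (X s.toNNReal ω) e i j) volume 0 t :=
      (((continuous_apply j).comp (continuous_apply i)).comp
        ((hSdc e).comp (hωc.comp continuous_real_toNNReal))).intervalIntegrable _ _
    have h := hωeq t e i j
    cases β
    · have hre := intervalIntegral.intervalIntegral_re hint
      simp only [RCLike.re_to_complex] at hre
      have h' := congrArg Complex.re h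
      simp only [Complex.add_re, Complex.re_sum, ← hre] at h'
      simpa using h'
    · have him := intervalIntegral.intervalIntegral_im hint
      simp only [RCLike.im_to_complex] at him
      have h' := congrArg Complex.im h
      simp only [Complex.add_im, Complex.im_sum, ← him] at h'
      simpa using h'
  · -- first tangency identity
    intro t ω
    have h1 : ∑ k : Fin 2 × Fin 2 × Bool,
        (if k.2.2 then (X t ω e k.1 k.2.1).im else (X t ω e k.1 k.2.1).re) *
          (if k.2.2 then (S.drift (X t ω) e k.1 k.2.1).im else (S.drift (X t ω) e k.1 k.2.1).re) =
        hsForm 2 (S.drift (X t ω) e) (X t ω e) := by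
      rw [sum_reIm_mul_eq_hsForm, hsForm_comm]
    have h2 : ∑ k : Fin 2 × Fin 2 × Bool, ∑ n,
        (if k.2.2 then (S.noise (X t ω) e n k.1 k.2.1).im else (S.noise (X t ω) e n k.1 k.2.1).re) ^ 2 =
        ∑ n, hsForm 2 (S.noise (X t ω) e n) (S.noise (X t ω) e n) := by
      rw [Finset.sum_comm]
      exact Finset.sum_congr rfl fun n _ => sum_reIm_sq_eq_hsForm _
    rw [h1, h2]
    exact hT1 (X t ω) e
  · -- second tangency identity
    intro t ω n
    rw [sum_reIm_mul_eq_hsForm, hsForm_comm]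
    exact hT2 (X t ω) e n

end Summit.QuantumFields.YangMills.Theorems.ColdStartUniversality

end
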